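import Summits.BirchSwinnertonDyer.BirchSwinnertonDyer.Theorems.EisensteinPrimesFullDescentAssemblyPrime
import Summits.BirchSwinnertonDyer.BirchSwinnertonDyer.Theorems.EisensteinPrimesFullDescentTheoremAIPrime
import Summits.BirchSwinnertonDyer.BirchSwinnertonDyer.Theorems.EisensteinPrimesFullDescentTheoremAIIPrime
import HarnessLib

/-!
# Crux 2 `GoodLatticeBDPValue` (stmt-BirchSwinnertonDyer-19032), line `halves`, road R5 / AN-5 — **T‴ CLOSED: a full-descent
# datum at every good Eisenstein prime `p ≥ 5` under the good-lattice normalisation (the `5 ≤ p` twin of stub 3a-B / Theorem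
# T′ `GoodLatticeBDPValueFullDescentStub.stub_fullDescentAtThreeOfRed`), and the count-reducing corollary
# `thm222_anacong_goodLattice_of_five_le ⟸ thm222_anacong_goodLattice_of_fullDescentDatum`**

Cell `bsd-eis` (home `run/shared/lean/pub/bsd-eis/`), width seat `bsd-line-x1-p1-w7` (gen 7; `--supports -19032`, closes no
registered stub by itself). Road R5 (HOME STATUS 2026-08-28 21:34Z; seats w7 g7 (HS-1/HS-2/A-I_p/ASM_p/this file), w3 g13
(TA-p/TA-p-loc/OrdinaryAtPrime/A-II_p), w5 g6 (LS-ω_p), w6 g8 (G2)) — the `5 ≤ p` twin of w3 gen 4's elementary road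
(`HOME/line-x1-p1-w3-g4/AN3-StubB-elementary-road.md`) at level `p`/`p²`, CASE ω only, whose one new input versus `p = 3`
(Herbrand's `A(ω⁻¹) = 0` for `ℚ(ζ_p)`, `p ∤ B₂`) is the tree theorem `Literature.NumberTheory.EllipticCurves.Mazur1977_herbrand`:

* `theoremA_prime` — **Theorem A_p** (Case `ω` ⇒ ⊥): A-I_p `FullDescentTheoremAIPrime.exists_stable_sq_of_omega_point` (the
  extension `p⁻¹C/C` of `ω` by `𝟙` splits — Herbrand splitting — giving a rational cyclic `B ≤ E[p²]` of order `p²` over the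
  `ω`-line) followed by A-II_p `FullDescentTheoremAPrime.false_of_stable_sq` (`ψ_B = χ̄_{p²}` by (G-ℚ), `Γ_ℚ` trivial on
  `E[p²]/B = E[p²]/K₂`, impossible at `p`: `p² ≤ #Ẽ(𝔽_p) ≤ 2p + 1`);
* **`fullDescentDatum_of_five_le`** — T‴: for `W/ℚ` globally minimal, `5 ≤ p` good with `E[p]` reducible and every rational
  `p`-line ramified at `p`, `E` has an additive prime, or a multiplicative prime `ℓ` that is split with `ℓ ≡ 1 (mod p)` or non-split
  with `ℓ + 1 ≡ 0 (mod p)` (`FullDescentAssemblyPrime.fullDescentDatum_of_theoremA theoremA_prime`; Ribet–Yoo necessity for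
  `E/ℚ`, Yoo 2019 Thm. 1.3, here UNCONDITIONAL and kernel-checked);
* **`thm222_anacong_goodLattice_of_five_le_of_fullDescentDatum`** — the count-reducing reading: the composed-print name
  `KellerYin2024.thm222_anacong_goodLattice_of_five_le` (stub_publishedFactsMore .2.1 of `Cruxes/GoodLatticeBDPValue/Lines/halves
  .lean` v25) FOLLOWS from 3a-A `KellerYin2024.thm222_anacong_goodLattice_of_fullDescentDatum` (stub 2) — the LEAD may re-point
  the skeleton (one Literature name fewer by name); nothing is asserted about either named fact.

HONEST FRAMING: 0 definitions, 0 named facts, 0 sorry. This file proves T‴ (a theorem about elliptic curves over `ℚ`) and a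
pure-logic bridge between two Literature statements; it does NOT prove 3a-A, `_of_five_le`, Keller–Yin Thm. 2.2.2, the crux
`GoodLatticeBDPValue`, any case of BSD or any summit statement; 0 cells / labels / tiers move. References: [Yoo2019] H. Yoo,
Trans. AMS 371 (2019), Thm. 1.3; [Mazur1977] Ch. I §2 (2.8)–(2.9), Ch. III §5 p. 158; [Kriz2016] Def. 31 (5), Rem. 33, Thm. 34,
Thm. 35; [CastellaGrossiLeeSkinner2022] Thms. 2.2.1/2.2.2 with (2.16); [SerreInventiones1972] §1.11–1.12.
-/

set_option autoImplicit false

-- the route's Theorems namespace repeats the summit name by design (D-0017 nested layout)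
set_option linter.dupNamespace false

noncomputable section

open scoped Classical NumberField

namespace Summit.BirchSwinnertonDyer.BirchSwinnertonDyer.Theorems.GoodLatticeBDPValueFullDescentFiveLe

open NumberField IsDedekindDomain Field WeierstrassCurve Rat.HeightOneSpectrum
  Literature.NumberTheory.EllipticCurves Literature.NumberTheory.GaloisRepresentations
  Literature.NumberTheory.EllipticCurves.Rank1Residual
  Summit.BirchSwinnertonDyer.BirchSwinnertonDyer.Theorems

/-- **Theorem A_p (road R5 / AN-5, Case `ω` ⇒ ⊥), every odd prime `p`.** `W/ℚ` globally minimal, `p` odd of good ORDINARY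
reduction, every finite place `v ∤ p` good or split multiplicative with `ℓ_v ≢ 1 (mod p)`, and `Q ≠ 0` in `E[p]` with
`σ Q = χ̄_p(σ) Q` ⟹ `False`: A-I_p (`FullDescentTheoremAIPrime.exists_stable_sq_of_omega_point`, Herbrand splitting) then A-II_p
(`FullDescentTheoremAPrime.false_of_stable_sq`). [cite: Mazur1977, Ch. III §5 p. 158] [cite: SerreInventiones1972, §1.11 Prop. 11]
[cite: Kriz2016, Thm. 34 (2)–(3)] -/
theorem theoremA_prime : ∀ (W : WeierstrassCurve ℚ) [W.IsElliptic] [W.IsGloballyMinimal] (p : ℕ) [Fact p.Prime],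
    p ≠ 2 → W.HasGoodReductionAtPrime p → ¬ (p : ℤ) ∣ W.frobeniusTrace p →
    (∀ v : HeightOneSpectrum (𝓞 ℚ), natGenerator v ≠ p →
      W.HasGoodReductionAt v ∨ (W.HasSplitMultiplicativeReductionAt v ∧ ¬ natGenerator v ≡ 1 [MOD p])) →
    ∀ Q : geomTorsion W (p : ℤ), Q ≠ 0 →
      (∀ σ : absoluteGaloisGroup ℚ, σ • Q = ((modNCyclotomicCharacter ℚ p σ : (ZMod p)ˣ) : ZMod p).val • Q) →
      False := by
  intro W _ _ p _ hp2 hgood hord hH Q hQ0 hQ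
  obtain ⟨B, -, hB2, hcard, hBinf, hBst⟩ :=
    FullDescentTheoremAIPrime.exists_stable_sq_of_omega_point W hp2 hgood hord hH Q hQ0 hQ
  exact FullDescentTheoremAPrime.false_of_stable_sq W hp2 hgood hord hH hQ0 hQ hB2 hcard hBinf hBst

/-- **T‴ — a full-descent datum at every good Eisenstein prime `p ≥ 5` under the good-lattice normalisation** (the `5 ≤ p`
twin of stub 3a-B `stub_fullDescentAtThreeOfRed`; Ribet–Yoo necessity for `E/ℚ`): for `W/ℚ` globally minimal, `5 ≤ p` good
with `E[p]` reducible and every rational `p`-line ramified at `p`, EITHER an additive prime exists OR a multiplicative prime `ℓ`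
exists that is split with `ℓ ≡ 1 (mod p)` or non-split with `ℓ + 1 ≡ 0 (mod p)`. UNCONDITIONAL.
[cite: Yoo2019, Thm. 1.3] [cite: Kriz2016, Def. 31 (5), Rem. 33, Thm. 34 (1)–(3), Thm. 35] [cite: Mazur1977, Ch. III §5 p. 158] -/
theorem fullDescentDatum_of_five_le :
    ∀ (W : WeierstrassCurve ℚ) [W.IsElliptic] [W.IsGloballyMinimal] (p : ℕ) [Fact p.Prime],
      5 ≤ p → Good W p → Red W p →
      (∀ Φ : AddSubgroup (geomTorsion W (p : ℤ)), IsRationalLine W p Φ → ¬ LineUnramifiedAt W p Φ) →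
      ((∃ (ℓ : ℕ) (hℓ : ℓ.Prime), haveI : Fact ℓ.Prime := ⟨hℓ⟩; Addv W ℓ) ∨
        (∃ (ℓ : ℕ) (hℓ : ℓ.Prime), haveI : Fact ℓ.Prime := ⟨hℓ⟩;
          W.HasMultiplicativeReductionAtPrime ℓ ∧
            ((W.HasSplitMultiplicativeReductionAtPrime ℓ ∧ ℓ ≡ 1 [MOD p]) ∨
              (¬ W.HasSplitMultiplicativeReductionAtPrime ℓ ∧ ℓ + 1 ≡ 0 [MOD p])))) :=
  FullDescentAssemblyPrime.fullDescentDatum_of_theoremA theoremA_prime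

/-- **The count-reducing corollary of road R5: `_of_five_le ⟸ _of_fullDescentDatum`.** The composed-print statement
`KellerYin2024.thm222_anacong_goodLattice_of_five_le` (CGLS 2.2.1/2.2.2 ∘ Kriz Rem. 33 ∘ Hida at `5 ≤ p`) follows from 3a-A
`KellerYin2024.thm222_anacong_goodLattice_of_fullDescentDatum` (the same composition GIVEN a full-descent datum), the datum being
supplied by `fullDescentDatum_of_five_le`. Bookkeeping over T‴; nothing is asserted about either named fact.
[cite: CastellaGrossiLeeSkinner2022, Thms. 2.2.1/2.2.2 with (2.16)] [cite: Kriz2016, Def. 31 (5), Rem. 33, Thm. 34 (3), Thm. 35]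
[cite: Yoo2019, Thm. 1.3] -/
theorem thm222_anacong_goodLattice_of_five_le_of_fullDescentDatum
    (h : KellerYin2024.thm222_anacong_goodLattice_of_fullDescentDatum) :
    KellerYin2024.thm222_anacong_goodLattice_of_five_le :=
  FullDescentAssemblyPrime.thm222_anacong_goodLattice_of_five_le_of_fullDescentDatum_of_datum fullDescentDatum_of_five_le h

end Summit.BirchSwinnertonDyer.BirchSwinnertonDyer.Theorems.GoodLatticeBDPValueFullDescentFiveLe

end
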